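import Summits.MatrixMultiplication.MatrixMultiplication.Theorems.SoloInformedCwTwoCubeKoszulFourCertB

/-!
# `bR(T_{cw,2}^{⊠3}) ≥ 48` — last part of the kernel checks, and the theorem

Solo work (`solo-MatrixMultiplication-informed`), new mathematics under the summit `MatrixMultiplication`.
The last 14 chunks of row checks of the certificate `cert48` (`SoloInformedCwTwoCubeKoszulFourCert.lean`,
`…CertB.lean`), their
concatenation, `rank_ℂ K(soloM) ≥ 3315`, and the consequences (Landsberg–Ottaviani flattening bound with
CGLV Prop. 3.2, `1_A`-generic factor `X^{⊠(N-3)}`, `T_{cw,2} ⊵ X`):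

  `3315 · 3^{N-3} ≤ 70 · bR(T_{cw,2}^{⊠N})` for all `N ≥ 3`, in particular `bR(T_{cw,2}^{⊠3}) ≥ 48`

(`70 · 47 = 3290 < 3315`; CGLV 2022 Thm. 1.2 (iii): `≥ 45`; in-tree `p = 3`: `≥ 46`; upper bound `64`).

## References

* A. Conner, F. Gesmundo, J. M. Landsberg, E. Ventura, *Rank and border rank of Kronecker powers of
  tensors and Strassen's laser method*, comput. complexity 31 (2022), Thm. 1.2, Prop. 3.2, Cor. 3.5,
  Rem. 3.6; arXiv:1909.04785v2. [ConnerGesmundoLandsbergVentura2022]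
* J. M. Landsberg, G. Ottaviani, *New lower bounds for the border rank of matrix multiplication*,
  Theory Comput. 11 (2015), §2. [LandsbergOttaviani2015]
-/

set_option Elab.async false

open Matrix

namespace Summit.MatrixMultiplication.MatrixMultiplication.Theorems

open Literature.Computability.AlgebraicComplexity

namespace CubeP4

set_option maxHeartbeats 0 in
/-- Rows `2240 ≤ i < 2320` of the certificate pass (kernel evaluation). [folklore] -/
theorem cert48_rows_28 : RowLU.rowsCheckP 3 (entNat 3) cand cert48 2240 80 = true := by decide +kernel

set_option maxHeartbeats 0 in
/-- Rows `2320 ≤ i < 2400` of the certificate pass (kernel evaluation). [folklore] -/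
theorem cert48_rows_29 : RowLU.rowsCheckP 3 (entNat 3) cand cert48 2320 80 = true := by decide +kernel

set_option maxHeartbeats 0 in
/-- Rows `2400 ≤ i < 2480` of the certificate pass (kernel evaluation). [folklore] -/
theorem cert48_rows_30 : RowLU.rowsCheckP 3 (entNat 3) cand cert48 2400 80 = true := by decide +kernel

set_option maxHeartbeats 0 in
/-- Rows `2480 ≤ i < 2560` of the certificate pass (kernel evaluation). [folklore] -/
theorem cert48_rows_31 : RowLU.rowsCheckP 3 (entNat 3) cand cert48 2480 80 = true := by decide +kernel

set_option maxHeartbeats 0 in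
/-- Rows `2560 ≤ i < 2640` of the certificate pass (kernel evaluation). [folklore] -/
theorem cert48_rows_32 : RowLU.rowsCheckP 3 (entNat 3) cand cert48 2560 80 = true := by decide +kernel

set_option maxHeartbeats 0 in
/-- Rows `2640 ≤ i < 2720` of the certificate pass (kernel evaluation). [folklore] -/
theorem cert48_rows_33 : RowLU.rowsCheckP 3 (entNat 3) cand cert48 2640 80 = true := by decide +kernel

set_option maxHeartbeats 0 in
/-- Rows `2720 ≤ i < 2800` of the certificate pass (kernel evaluation). [folklore] -/
theorem cert48_rows_34 : RowLU.rowsCheckP 3 (entNat 3) cand cert48 2720 80 = true := by decide +kernel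

set_option maxHeartbeats 0 in
/-- Rows `2800 ≤ i < 2880` of the certificate pass (kernel evaluation). [folklore] -/
theorem cert48_rows_35 : RowLU.rowsCheckP 3 (entNat 3) cand cert48 2800 80 = true := by decide +kernel

set_option maxHeartbeats 0 in
/-- Rows `2880 ≤ i < 2960` of the certificate pass (kernel evaluation). [folklore] -/
theorem cert48_rows_36 : RowLU.rowsCheckP 3 (entNat 3) cand cert48 2880 80 = true := by decide +kernel

set_option maxHeartbeats 0 in
/-- Rows `2960 ≤ i < 3040` of the certificate pass (kernel evaluation). [folklore] -/
theorem cert48_rows_37 : RowLU.rowsCheckP 3 (entNat 3) cand cert48 2960 80 = true := by decide +kernel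

set_option maxHeartbeats 0 in
/-- Rows `3040 ≤ i < 3120` of the certificate pass (kernel evaluation). [folklore] -/
theorem cert48_rows_38 : RowLU.rowsCheckP 3 (entNat 3) cand cert48 3040 80 = true := by decide +kernel

set_option maxHeartbeats 0 in
/-- Rows `3120 ≤ i < 3200` of the certificate pass (kernel evaluation). [folklore] -/
theorem cert48_rows_39 : RowLU.rowsCheckP 3 (entNat 3) cand cert48 3120 80 = true := by decide +kernel

set_option maxHeartbeats 0 in
/-- Rows `3200 ≤ i < 3280` of the certificate pass (kernel evaluation). [folklore] -/
theorem cert48_rows_40 : RowLU.rowsCheckP 3 (entNat 3) cand cert48 3200 80 = true := by decide +kernel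

set_option maxHeartbeats 0 in
/-- Rows `3280 ≤ i < 3315` of the certificate pass (kernel evaluation). [folklore] -/
theorem cert48_rows_41 : RowLU.rowsCheckP 3 (entNat 3) cand cert48 3280 35 = true := by decide +kernel

/-- All `3315` row checks pass. [folklore] -/
theorem cert48_allRows (i : ℕ) (hi : i < cert48.k) :
    RowLU.rowCheckP 3 (entNat 3) cand cert48 i = true := by
  change i < 3315 at hi
  have h := cert48_rows_0
  have h := rowsCheckP_split _ h cert48_rows_1
  have h := rowsCheckP_split _ h cert48_rows_2
  have h := rowsCheckP_split _ h cert48_rows_3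
  have h := rowsCheckP_split _ h cert48_rows_4
  have h := rowsCheckP_split _ h cert48_rows_5
  have h := rowsCheckP_split _ h cert48_rows_6
  have h := rowsCheckP_split _ h cert48_rows_7
  have h := rowsCheckP_split _ h cert48_rows_8
  have h := rowsCheckP_split _ h cert48_rows_9
  have h := rowsCheckP_split _ h cert48_rows_10
  have h := rowsCheckP_split _ h cert48_rows_11
  have h := rowsCheckP_split _ h cert48_rows_12
  have h := rowsCheckP_split _ h cert48_rows_13
  have h := rowsCheckP_split _ h cert48_rows_14
  have h := rowsCheckP_split _ h cert48_rows_15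
  have h := rowsCheckP_split _ h cert48_rows_16
  have h := rowsCheckP_split _ h cert48_rows_17
  have h := rowsCheckP_split _ h cert48_rows_18
  have h := rowsCheckP_split _ h cert48_rows_19
  have h := rowsCheckP_split _ h cert48_rows_20
  have h := rowsCheckP_split _ h cert48_rows_21
  have h := rowsCheckP_split _ h cert48_rows_22
  have h := rowsCheckP_split _ h cert48_rows_23
  have h := rowsCheckP_split _ h cert48_rows_24
  have h := rowsCheckP_split _ h cert48_rows_25
  have h := rowsCheckP_split _ h cert48_rows_26
  have h := rowsCheckP_split _ h cert48_rows_27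
  have h := rowsCheckP_split _ h cert48_rows_28
  have h := rowsCheckP_split _ h cert48_rows_29
  have h := rowsCheckP_split _ h cert48_rows_30
  have h := rowsCheckP_split _ h cert48_rows_31
  have h := rowsCheckP_split _ h cert48_rows_32
  have h := rowsCheckP_split _ h cert48_rows_33
  have h := rowsCheckP_split _ h cert48_rows_34
  have h := rowsCheckP_split _ h cert48_rows_35
  have h := rowsCheckP_split _ h cert48_rows_36
  have h := rowsCheckP_split _ h cert48_rows_37
  have h := rowsCheckP_split _ h cert48_rows_38
  have h := rowsCheckP_split _ h cert48_rows_39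
  have h := rowsCheckP_split _ h cert48_rows_40
  have h := rowsCheckP_split _ h cert48_rows_41
  have h' : RowLU.rowsCheckP 3 (entNat 3) cand cert48 0 3315 = true := h
  exact RowLU.rowsCheckP_spec h' (Nat.zero_le i) (by omega)

/-- **`rank_ℂ K(soloM) ≥ 3315`.** [folklore] -/
theorem rank_KZ_ge : 3315 ≤ (KZ.map (Int.castRingHom ℂ)).rank :=
  rank_ge_of_cert (pr := 3) (by decide) cert48 cert48_glob cert48_allRows

/-- **`3315 · 3^{N-3} ≤ 70 · bR(T_{cw,2}^{⊠N})` for `N ≥ 3`** (Koszul flattening `p = 4` of the cube,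
propagated by CGLV Prop. 3.2). [cite: ConnerGesmundoLandsbergVentura2022, Prop. 3.2, Cor. 3.5 (proof)] -/
theorem le_algBorderRank_kroneckerPow_cwTensor_two_p4 (N : ℕ) (hN : 3 ≤ N) :
    3315 * 3 ^ (N - 3) ≤ 70 * algBorderRank (kroneckerPow (cwTensor ℂ 2) N) :=
  le_algBorderRank_kroneckerPow_cwTensor_two_of_rank_four rank_KZ_ge N hN

end CubeP4

open CubeP4 in
/-- **`bR(T_{cw,2}^{⊠3}) ≥ 48`** (new; CGLV 2022 Thm. 1.2 (iii): `≥ 45`; in-tree `p = 3`: `≥ 46`).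
[cite: ConnerGesmundoLandsbergVentura2022, Thm. 1.2 (iii), Rem. 3.6] -/
theorem le_algBorderRank_kroneckerPow_cwTensor_two_three_p4 :
    48 ≤ algBorderRank (kroneckerPow (cwTensor ℂ 2) 3) := by
  have h := le_algBorderRank_kroneckerPow_cwTensor_two_p4 3 le_rfl
  norm_num at h
  omega

end Summit.MatrixMultiplication.MatrixMultiplication.Theorems
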